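import Literature.Analysis.FluidPDE.TaoH1APrioriForcedToolkit
import HarnessLib

/-!
# Quantitative regularity WITH FORCE (Tao 2011, Lemma 5.5 = arXiv Lemma 32, `f ≠ 0`):
# positive-time `H^k` bounds for classical solutions of the forced system, uniform in the solution

Analysis/FluidPDE proof file (cell `pub/ns-blowup`, seat `ns-blowup-lean` g8; piece P2 of the
chain «`tao2011_forced_H1_local_almost_regular` (p428734) ⇐ F2
`tao2011_smooth_local_existence_forced_holds`», lit g11 STATUS l.3415 / lean2 g4 l.3870). WHAT
THIS IS NOT: not a statement about Navier–Stokes blow-up — parabolic smoothing bookkeeping for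
classical solutions of the FORCED system; nothing is constructed. No definitions, no named facts.

**Tao 2011, Lemma 5.5 = arXiv Lemma 32** (p. 18, line 88, printed WITH the forcing term): "Let
`(u, p, u₀, f, T)` be an `H¹` mild solution obeying (D4) for a sufficiently small absolute constant
`c > 0`, and such that `‖u₀‖_{H¹_x(ℝ³)} + ‖f‖_{L¹_t H^k_x(ℝ³)} ≤ M < ∞`. Then one has
`‖u‖_{L^∞_t H^k_x([τ,T] × ℝ³)} ≲_{k,τ,T,M} 1` for all natural numbers `k ≥ 1` and all `0 < τ < T`."
The tree holds the homogeneous case as `tao2011_quantitative_regularity_holds`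
(`TaoH1APrioriProofs.lean`: the physical-space vorticity energy method of `NSVorticitySlice` →
`NSEnstrophyPersistence` → `NSH1BoundedSmoothing` re-threaded with the constants chosen BEFORE the
solution) and the forced persistence of regularity in qualitative form
(`NSEnstrophyPersistenceForced.lean`, lit g10: `slice_energy_inequality_forced`,
`uniform_enstrophy_bounds_forced`, `sobolev_step_forced`). This file is the FORCED twin of the
quantitative file, with the force bounds quantified before the solution as well:

* `tao2011_quantitative_regularity_forced` — for every order `k`, viscosity `ν > 0`, times
  `0 < τ < T`, bounds `E, S, I` and a family of force bounds `F m` (`m : ℕ`) there is a constant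
  `C = C(k, ν, τ, T, E, S, I, F)` such that EVERY classical solution `(u, p)` of the forced system
  with force `f` on `[0, T] × ℝ³` with `∫ ‖Dᵐf(t)‖² ≤ F m` (`t ∈ [0, T]`, all `m` — Tao's smooth
  `L^∞_t H^k_x` forces, in particular the Clay class), `∫|u(t)|² ≤ E`, `∫|∇u(t)|² ≤ S`
  (`t ∈ [0, T]`) and `∫₀ᵀ∫‖D²u‖² ≤ I` obeys `∫ ‖Dᵏu(t)‖² ≤ C` for all `t ∈ [τ, T]` — exactly the
  shape of `tao2011_quantitative_regularity` with the force slot opened (the unused smooth-class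
  hypotheses of the homogeneous fact are dropped), which is what the forced almost-regular
  assembly (P6: limit of same-force approximants) consumes.

The chain, constant first (each step the forced twin of the `_quant` step of
`TaoH1APrioriProofs.lean`, the force entering only through the pairing
`sum_integral_cutoff_force_pairing_le_anyForce` in the slice inequality, with `C₀ = C₀^{core} + 1 + 4F`):
`slice_energy_inequality_forced_quant` → `uniform_enstrophy_bounds_forced_quant` →
`sobolev_step_forced_quant` → `sobolevLevels_succ_forced_quant` (restart at a quantitative good
time, `exists_integral_levelSq_le_anyForce`, translating the FORCE with the solution — its slab
bounds persist) → `sobolevLevels_forced_quant` → `tao2011_quantitative_regularity_forced`.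

## References

* T. Tao, *Localisation and compactness properties of the Navier–Stokes global regularity
  problem*, Anal. PDE 6 (2013) = arXiv:1108.1165, Lemma 5.5 = arXiv Lemma 32 (pp. 18–19), Thm. 5.4
  (iv) with the note closing its proof. [Tao2011]
* C. R. Doering, J. D. Gibbon, *Applied Analysis of the Navier–Stokes Equations*, CUP 1995, §6.2
  Thm. 6.1 with (6.2.8), p. 99. [DoeringGibbon1995]
* A. J. Majda, A. L. Bertozzi, *Vorticity and Incompressible Flow*, CUP 2002, §3.2 Prop. 3.7.
  [MajdaBertozziCUP2002]
* J. C. Robinson, J. L. Rodrigo, W. Sadowski, CUP 2016, Thm. 7.1 with (7.2)–(7.3).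
  [RobinsonRodrigoSadowski2016]
-/

noncomputable section

open MeasureTheory Set Function Filter Topology
open scoped ENNReal NNReal ContDiff BigOperators

namespace Literature.Analysis.FluidPDE

/-! ## The slice inequality and Grönwall, uniformly in the solution and the force -/

/-- **The slice energy inequality WITH force, uniformly in the solution.** Given `ν > 0`, `n ≥ 1`,
nonnegative constants `S m` and `F ≥ 0`, there is `C₀` such that for every classical solution `u`
of the forced system (force `f`) on a slab `[0, T] × ℝ³`, all `R ≥ 1` and all `t ∈ [0, T]` at which
`∫ |∇ᵐu(t)|² ≤ S m` for `m ≤ n` and `∫ |∇^{n+1}f(t)|² ≤ F`: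
`∑ 2 ∫ χ_R⁴ ∂ₜ(∂^βΩ_{ki}) ∂^βΩ_{ki} ≤ −ν ∫ χ_R⁴ |∇^{n+1}Ω|² + C₀ (1 + ∫ χ_R⁴ |∇ⁿΩ|² + ∫ χ_R² |∇^{n+1}u|²)`
(the tree's `slice_energy_inequality_forced` with its constant `C₀ = C₀^{core} + 1 + 4F` chosen
before the solution). [cite: DoeringGibbon1995, §6.2 Thm. 6.1 with eq. (6.2.8) (p. 99)] -/
theorem slice_energy_inequality_forced_quant {ν : ℝ} (hν : 0 < ν) {n : ℕ} (hn : 1 ≤ n)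
    (S : ℕ → ℝ) (hS : ∀ m, 0 ≤ S m) {F : ℝ} (hF : 0 ≤ F) :
    ∃ C₀ : ℝ, 0 ≤ C₀ ∧ ∀ ⦃T : ℝ⦄ ⦃f u : ℝ → EuclideanSpace ℝ (Fin 3) → EuclideanSpace ℝ (Fin 3)⦄
      ⦃p : ℝ → EuclideanSpace ℝ (Fin 3) → ℝ⦄,
      IsClassicalNSSolutionOn (Icc 0 T) ν f u p → 0 < T → ∀ R : ℝ, 1 ≤ R → ∀ t ∈ Icc 0 T,
      (∀ m ≤ n, Integrable (levelSq m (u t))) → (∀ m ≤ n, ∫ x, levelSq m (u t) x ≤ S m) →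
      Integrable (levelSq (n + 1) (f t)) → ∫ x, levelSq (n + 1) (f t) x ≤ F →
      ∑ c', 2 * ∫ x, cutoff R x ^ 4 *
          (FluidPDE.timeDerivWithin (Icc 0 T) (fun s y => vortFam n (u s) c' y) t x *
            vortFam n (u t) c' x) ≤
        -ν * (∫ x, cutoff R x ^ 4 * vortSq (n + 1) (u t) x) +
          C₀ * (1 + (∫ x, cutoff R x ^ 4 * vortSq n (u t) x) +
            ∫ x, cutoff R x ^ 2 * levelSq (n + 1) (u t) x) := by
  obtain ⟨c, hc0, hc⟩ := exists_norm_fderiv_cutoff_le (E := (EuclideanSpace ℝ (Fin 3)))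
  have hCF : (0 : ℝ) ≤ 2 * 3 * 2 ^ (n + 1) := by positivity
  obtain ⟨C₀, hC₀0, hC₀⟩ := slice_energy_inequality_core hν hc0 hCF hn S hS
  refine ⟨C₀ + 1 + 4 * F, by positivity, fun T f u p h hT R hR t ht hint hSv hfi hfF => ?_⟩
  have hR0 : 0 < R := by linarith
  have hU := uniqueDiffOn_Icc hT
  have hcl := Icc_subset_closure_interior hT
  have hv : ContDiff ℝ ∞ (u t) := h.contDiff_velocity ht
  have hg : ContDiff ℝ ∞ (f t) := h.contDiff_force hU ht
  have hdiv : ∀ x, ∑ i, pderiv i (fun y => u t y i) x = 0 := fun x =>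
    h.sum_pderiv_comp_eq_zero ht x
  -- the cutoffs
  have hgrad : ∀ {R'}, 1 ≤ R' → ∀ x, ‖fderiv ℝ (cutoff R') x‖ ≤ c := fun {R'} hR' x =>
    (hc R' (by linarith) x).trans (div_le_self hc0 hR')
  -- the time derivatives, with the force term subtracted
  have hWtc : ∀ c', Continuous fun x =>
      FluidPDE.timeDerivWithin (Icc 0 T) (fun s y => vortFam n (u s) c' y) t x := fun c' =>
    (((h.isSmoothSpaceTimeOn_vortFam_anyForce hT n c').timeDerivWithin hU).contDiff_slice
      ht).continuous
  have hGc : ∀ c', Continuous (vortFam n (f t) c') := fun c' => (contDiff_vortFam hg n c').continuous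
  have hWc : ∀ c', Continuous fun x =>
      FluidPDE.timeDerivWithin (Icc 0 T) (fun s y => vortFam n (u s) c' y) t x -
        vortFam n (f t) c' x :=
    fun c' => (hWtc c').sub (hGc c')
  have hforce : ∀ c' x,
      |(FluidPDE.timeDerivWithin (Icc 0 T) (fun s y => vortFam n (u s) c' y) t x -
          vortFam n (f t) c' x) -
        ν * ∑ j, pderiv j (pderiv j (vortFam n (u t) c')) x +
        ∑ j, u t x j * pderiv j (vortFam n (u t) c') x| ≤
      2 * 3 * 2 ^ (n + 1) * ∑ a ∈ Finset.Icc 1 (n + 1),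
        Real.sqrt (levelSq a (u t) x) * Real.sqrt (levelSq (n + 2 - a) (u t) x) := by
    intro c' x
    have := h.abs_vorticity_forcing_sub_force_le hU hcl ht x c'.1 c'.2.1 c'.2.2
    rw [Fintype.card_fin] at this
    push_cast at this
    exact this
  have hcore := hC₀ (u t) (cutoff R) (cutoff (2 * R)) _ hv hdiv (contDiff_cutoff R)
    (hasCompactSupport_cutoff hR0) (cutoff_nonneg R) (cutoff_le_one R) (hgrad hR)
    (contDiff_cutoff (2 * R)) (hasCompactSupport_cutoff (by linarith)) (cutoff_nonneg (2 * R))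
    (cutoff_le_one (2 * R)) (hgrad (by linarith)) (fun x hx => cutoff_two_mul_eq_one_of_ne hR0 hx)
    hWc hforce hint hSv
  -- the force pairing
  have hpair := sum_integral_cutoff_force_pairing_le_anyForce hv hg hR0 n hfi
  -- split `Ẇ W = (Ẇ − G) W + G W` under the integrals
  have hχc : Continuous (cutoff (E := (EuclideanSpace ℝ (Fin 3))) R) :=
    (contDiff_cutoff (n := 0) R).continuous
  have hχs : HasCompactSupport (cutoff (E := (EuclideanSpace ℝ (Fin 3))) R) :=
    hasCompactSupport_cutoff hR0
  have cW : ∀ c', Continuous (vortFam n (u t) c') := fun c' => (contDiff_vortFam hv n c').continuous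
  have hsplit : ∀ c', ∫ x, cutoff R x ^ 4 *
      (FluidPDE.timeDerivWithin (Icc 0 T) (fun s y => vortFam n (u s) c' y) t x *
        vortFam n (u t) c' x) =
      (∫ x, cutoff R x ^ 4 *
        ((FluidPDE.timeDerivWithin (Icc 0 T) (fun s y => vortFam n (u s) c' y) t x -
          vortFam n (f t) c' x) * vortFam n (u t) c' x)) +
      ∫ x, cutoff R x ^ 4 * (vortFam n (f t) c' x * vortFam n (u t) c' x) := by
    intro c'
    have i1 : Integrable fun x => cutoff R x ^ 4 *
        ((FluidPDE.timeDerivWithin (Icc 0 T) (fun s y => vortFam n (u s) c' y) t x -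
          vortFam n (f t) c' x) * vortFam n (u t) c' x) :=
      integrable_pow_mul_of_continuous hχc hχs ((hWc c').mul (cW c')) (by norm_num)
    have i2 : Integrable fun x => cutoff R x ^ 4 * (vortFam n (f t) c' x * vortFam n (u t) c' x) :=
      integrable_pow_mul_of_continuous hχc hχs ((hGc c').mul (cW c')) (by norm_num)
    rw [← integral_add i1 i2]
    refine integral_congr_ae (Eventually.of_forall fun x => ?_)
    simp only
    ring
  have hX0 : 0 ≤ ∫ x, cutoff R x ^ 4 * vortSq n (u t) x :=
    integral_nonneg fun x => mul_nonneg (pow_nonneg (cutoff_nonneg _ _) 4) (vortSq_nonneg _ _ _)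
  have hY0 : 0 ≤ ∫ x, cutoff R x ^ 2 * levelSq (n + 1) (u t) x :=
    integral_nonneg fun x => mul_nonneg (sq_nonneg _) (levelSq_nonneg _ _ _)
  have hsumeq : ∑ c', 2 * ∫ x, cutoff R x ^ 4 *
      (FluidPDE.timeDerivWithin (Icc 0 T) (fun s y => vortFam n (u s) c' y) t x *
        vortFam n (u t) c' x) =
      (∑ c', 2 * ∫ x, cutoff R x ^ 4 *
        ((FluidPDE.timeDerivWithin (Icc 0 T) (fun s y => vortFam n (u s) c' y) t x -
          vortFam n (f t) c' x) * vortFam n (u t) c' x)) +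
      ∑ c', 2 * ∫ x, cutoff R x ^ 4 * (vortFam n (f t) c' x * vortFam n (u t) c' x) := by
    rw [← Finset.sum_add_distrib]
    exact Finset.sum_congr rfl fun c' _ => by rw [hsplit c']; ring
  rw [hsumeq]
  nlinarith [hcore, hpair, hX0, hY0, hfF, hC₀0, hF]

/-- **Uniform localised bounds (Grönwall) WITH force, uniformly in the solution.** Given `ν > 0`,
`n ≥ 1`, a maximal time `T_max > 0`, nonnegative constants `S m`, `F ≥ 0`, `I ≥ 0` and `X₀ ≥ 0`,
there is `M ≥ 0` such that for every classical solution `u` of the forced system (force `f`) on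
`[0, T] × ℝ³` with `0 < T ≤ T_max`, `∫ |∇ᵐu(t)|² ≤ S m` (`m ≤ n`), `∫ |∇^{n+1}f(t)|² ≤ F`
(`t ∈ [0, T]`), `∫₀ᵀ ∫ χ_R² |∇^{n+1}u|² ≤ I` and `∫ χ_R⁴ |∇ⁿΩ(0)|² ≤ X₀` for all `R ≥ 1`:
`∫ χ_R⁴ |∇ⁿΩ(t)|² ≤ M` (`t ∈ [0, T]`) and `∫₀ᵀ ∫ χ_R⁴ |∇^{n+1}Ω|² ≤ M` for all `R ≥ 1` — explicitly
`M = max (A e^{C₀T_max}) ((A + C₀ T_max A e^{C₀T_max}) / ν)`, `A = X₀ + C₀ T_max + C₀ I` (the tree's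
`uniform_enstrophy_bounds_forced`, constant first). [cite: DoeringGibbon1995, §6.2 Thm. 6.1 with eq. (6.2.8) (p. 99)] -/
theorem uniform_enstrophy_bounds_forced_quant {ν Tmax : ℝ} (hν : 0 < ν) (hTmax : 0 < Tmax) {n : ℕ}
    (hn : 1 ≤ n) (S : ℕ → ℝ) (hS : ∀ m, 0 ≤ S m) {F I X₀ : ℝ} (hF : 0 ≤ F) (hI0 : 0 ≤ I)
    (hX₀0 : 0 ≤ X₀) :
    ∃ M : ℝ, 0 ≤ M ∧ ∀ ⦃T : ℝ⦄ ⦃f u : ℝ → EuclideanSpace ℝ (Fin 3) → EuclideanSpace ℝ (Fin 3)⦄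
      ⦃p : ℝ → EuclideanSpace ℝ (Fin 3) → ℝ⦄,
      IsClassicalNSSolutionOn (Icc 0 T) ν f u p → 0 < T → T ≤ Tmax →
      (∀ m ≤ n, ∀ t ∈ Icc 0 T, Integrable (levelSq m (u t)) ∧ ∫ x, levelSq m (u t) x ≤ S m) →
      (∀ t ∈ Icc 0 T, Integrable (levelSq (n + 1) (f t)) ∧ ∫ x, levelSq (n + 1) (f t) x ≤ F) →
      (∀ R : ℝ, 1 ≤ R →
        ∫ τ in Ioo 0 T, ∫ x, cutoff R x ^ 2 * levelSq (n + 1) (u τ) x ≤ I) →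
      (∀ R : ℝ, 1 ≤ R → ∫ x, cutoff R x ^ 4 * vortSq n (u 0) x ≤ X₀) →
      ∀ R : ℝ, 1 ≤ R →
        (∀ t ∈ Icc 0 T, ∫ x, cutoff R x ^ 4 * vortSq n (u t) x ≤ M) ∧
          ∫ τ in Ioo 0 T, ∫ x, cutoff R x ^ 4 * vortSq (n + 1) (u τ) x ≤ M := by
  obtain ⟨C₀, hC₀0, hC₀⟩ := slice_energy_inequality_forced_quant hν hn S hS hF
  set A : ℝ := X₀ + C₀ * Tmax + C₀ * I with hA
  have hA0 : 0 ≤ A := by positivity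
  set M₁ : ℝ := A * Real.exp (C₀ * Tmax) with hM₁
  have hM₁0 : 0 ≤ M₁ := by positivity
  refine ⟨max M₁ ((A + C₀ * (Tmax * M₁)) / ν), le_max_of_le_left hM₁0,
    fun T f u p h hT hTle hPS hPF hPI hX₀ R hR => ?_⟩
  have hR0 : 0 < R := by linarith
  have h0T : (0 : ℝ) ∈ Icc 0 T := ⟨le_rfl, hT.le⟩
  -- the four functions of time (opaque, with defining equations)
  obtain ⟨X, hX⟩ : ∃ X : ℝ → ℝ, X = fun t => ∫ x, cutoff R x ^ 4 * vortSq n (u t) x := ⟨_, rfl⟩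
  obtain ⟨D, hD⟩ : ∃ D : ℝ → ℝ, D = fun t => ∫ x, cutoff R x ^ 4 * vortSq (n + 1) (u t) x :=
    ⟨_, rfl⟩
  obtain ⟨Y, hY⟩ : ∃ Y : ℝ → ℝ, Y = fun t => ∫ x, cutoff R x ^ 2 * levelSq (n + 1) (u t) x :=
    ⟨_, rfl⟩
  obtain ⟨Φ, hΦ⟩ : ∃ Φ : ℝ → ℝ, Φ = fun t => ∑ c', 2 * ∫ x, cutoff R x ^ 4 *
      (FluidPDE.timeDerivWithin (Icc 0 T) (fun s y => vortFam n (u s) c' y) t x *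
        vortFam n (u t) c' x) := ⟨_, rfl⟩
  have cX : ContinuousOn X (Icc 0 T) := by
    rw [hX]; exact h.continuousOn_integral_cutoff_pow_mul_vortSq_anyForce hT hR0 4 n (by norm_num)
  have cD : ContinuousOn D (Icc 0 T) := by
    rw [hD]
    exact h.continuousOn_integral_cutoff_pow_mul_vortSq_anyForce hT hR0 4 (n + 1) (by norm_num)
  have cY : ContinuousOn Y (Icc 0 T) := by
    rw [hY]
    exact h.continuousOn_integral_cutoff_pow_mul_levelSq_anyForce hT hR0 2 (n + 1) (by norm_num)
  have cΦ : ContinuousOn Φ (Icc 0 T) := by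
    rw [hΦ]
    exact continuousOn_finsetSum _ fun c' _ =>
      (h.continuousOn_integral_cutoff_pow_mul_timeDerivWithin_mul_anyForce hT hR0 n c').const_smul
        (2 : ℝ) |>.congr fun t _ => by simp [smul_eq_mul]
  have hX0' : ∀ t, 0 ≤ X t := fun t => by
    rw [hX]; exact integral_nonneg fun x =>
      mul_nonneg (pow_nonneg (cutoff_nonneg _ _) 4) (vortSq_nonneg _ _ _)
  have hD0' : ∀ t, 0 ≤ D t := fun t => by
    rw [hD]; exact integral_nonneg fun x =>
      mul_nonneg (pow_nonneg (cutoff_nonneg _ _) 4) (vortSq_nonneg _ _ _)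
  have hY0' : ∀ t, 0 ≤ Y t := fun t => by
    rw [hY]; exact integral_nonneg fun x => mul_nonneg (sq_nonneg _) (levelSq_nonneg _ _ _)
  -- the slice inequality and the time identity
  have hSEI : ∀ τ ∈ Icc 0 T, Φ τ ≤ -ν * D τ + C₀ * (1 + X τ + Y τ) := fun τ hτ => by
    rw [hΦ, hD, hX, hY]
    exact hC₀ h hT R hR τ hτ (fun m hm => (hPS m hm τ hτ).1) (fun m hm => (hPS m hm τ hτ).2)
      (hPF τ hτ).1 (hPF τ hτ).2
  have hFTC : ∀ t ∈ Icc 0 T, X t - X 0 = ∫ τ in Ioo 0 t, Φ τ := fun t ht => by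
    rw [hX, hΦ]; exact h.integral_cutoff_vortSq_sub_eq_anyForce hT hR0 n ht
  -- integrate the slice inequality
  have hY_le : ∀ t ∈ Icc 0 T, ∫ τ in Ioo 0 t, Y τ ≤ I := fun t ht => by
    refine le_trans (setIntegral_mono_set (integrableOn_Ioo_of_continuousOn cY ⟨hT.le, le_rfl⟩)
      (ae_of_all _ fun τ => hY0' τ) (ae_of_all _ (Ioo_subset_Ioo le_rfl ht.2))) ?_
    rw [hY]; exact hPI R hR
  have hmain : ∀ t ∈ Icc 0 T, X t + ν * ∫ τ in Ioo 0 t, D τ ≤ A + C₀ * ∫ τ in Ioo 0 t, X τ := by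
    intro t ht
    have iΦ := integrableOn_Ioo_of_continuousOn cΦ ht
    have iX := integrableOn_Ioo_of_continuousOn cX ht
    have iD := integrableOn_Ioo_of_continuousOn cD ht
    have iY := integrableOn_Ioo_of_continuousOn cY ht
    have i1 : IntegrableOn (fun _ => (1 : ℝ)) (Ioo 0 t) :=
      integrableOn_const (by rw [Real.volume_Ioo]; exact ENNReal.ofReal_ne_top)
    have i1X : IntegrableOn (fun τ => 1 + X τ) (Ioo 0 t) := i1.add iX
    have iXY : IntegrableOn (fun τ => 1 + X τ + Y τ) (Ioo 0 t) := i1X.add iY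
    have iC : IntegrableOn (fun τ => C₀ * (1 + X τ + Y τ)) (Ioo 0 t) := iXY.const_mul _
    have iνD : IntegrableOn (fun τ => -ν * D τ) (Ioo 0 t) := iD.const_mul _
    have iR : IntegrableOn (fun τ => -ν * D τ + C₀ * (1 + X τ + Y τ)) (Ioo 0 t) := iνD.add iC
    have hmono : ∫ τ in Ioo 0 t, Φ τ ≤ ∫ τ in Ioo 0 t, (-ν * D τ + C₀ * (1 + X τ + Y τ)) :=
      setIntegral_mono_on iΦ iR measurableSet_Ioo fun τ hτ =>
        hSEI τ ⟨hτ.1.le, hτ.2.le.trans ht.2⟩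
    have e : ∫ τ in Ioo 0 t, (-ν * D τ + C₀ * (1 + X τ + Y τ)) =
        -ν * (∫ τ in Ioo 0 t, D τ) +
          C₀ * (t + (∫ τ in Ioo 0 t, X τ) + ∫ τ in Ioo 0 t, Y τ) := by
      rw [integral_add iνD iC, integral_const_mul, integral_const_mul, integral_add i1X iY,
        integral_add i1 iX, setIntegral_const, Real.volume_real_Ioo, sub_zero, max_eq_left ht.1,
        smul_eq_mul, mul_one]
    have h1 := hFTC t ht
    have h2 := hY_le t ht
    have h3 : X 0 ≤ X₀ := by rw [hX]; exact hX₀ R hR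
    have h4 : C₀ * t ≤ C₀ * Tmax := mul_le_mul_of_nonneg_left (ht.2.trans hTle) hC₀0
    rw [hA]
    nlinarith [mul_le_mul_of_nonneg_left h2 hC₀0]
  -- Grönwall
  have hG : ∀ t ∈ Icc 0 T, X t ≤ A * Real.exp (C₀ * t) := by
    refine le_mul_exp_of_le_add_mul_integral cX hC₀0 fun t ht => ?_
    rw [intervalIntegral.integral_of_le ht.1, integral_Ioc_eq_integral_Ioo]
    have := hmain t ht
    have hD_int : 0 ≤ ∫ τ in Ioo 0 t, D τ :=
      setIntegral_nonneg measurableSet_Ioo fun τ _ => hD0' τ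
    nlinarith [mul_nonneg hν.le hD_int]
  have hXM : ∀ t ∈ Icc 0 T, X t ≤ M₁ := fun t ht =>
    (hG t ht).trans (mul_le_mul_of_nonneg_left (Real.exp_le_exp.2
      (mul_le_mul_of_nonneg_left (ht.2.trans hTle) hC₀0)) hA0)
  -- the dissipation
  have hTT : T ∈ Icc 0 T := ⟨hT.le, le_rfl⟩
  have hXint : ∫ τ in Ioo 0 T, X τ ≤ Tmax * M₁ := by
    have iX := integrableOn_Ioo_of_continuousOn cX hTT
    have i1 : IntegrableOn (fun _ => M₁) (Ioo 0 T) :=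
      integrableOn_const (by rw [Real.volume_Ioo]; exact ENNReal.ofReal_ne_top)
    calc ∫ τ in Ioo 0 T, X τ ≤ ∫ _ in Ioo 0 T, M₁ :=
          setIntegral_mono_on iX i1 measurableSet_Ioo fun τ hτ => hXM τ ⟨hτ.1.le, hτ.2.le⟩
      _ = T * M₁ := by
          rw [setIntegral_const, Real.volume_real_Ioo, sub_zero, max_eq_left hT.le, smul_eq_mul]
      _ ≤ Tmax * M₁ := mul_le_mul_of_nonneg_right hTle hM₁0
  have hDM : ∫ τ in Ioo 0 T, D τ ≤ (A + C₀ * (Tmax * M₁)) / ν := by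
    rw [le_div_iff₀ hν]
    have := hmain T hTT
    nlinarith [hX0' T, mul_le_mul_of_nonneg_left hXint hC₀0]
  refine ⟨fun t ht => ?_, ?_⟩
  · have := hXM t ht
    rw [hX] at this
    exact this.trans (le_max_left _ _)
  · rw [hD] at hDM
    exact hDM.trans (le_max_right _ _)

/-! ## The persistence step with uniform constants -/

/-- **The induction step `Xⁿ → X^{n+1}` WITH force, uniformly in the solution.** Given `ν > 0`,
`n ≥ 1`, `T_max > 0`, nonnegative constants `S m`, a force bound `F ≥ 0`, `I ≥ 0` and a datum bound
`D₀ ≥ 0`, there is `M ≥ 0` such that for every classical solution `u` of the forced system (force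
`f`) on `[0, T] × ℝ³`, `0 < T ≤ T_max`, with `∫ |∇^{n+1}u(0)|² ≤ D₀`, `∫ |∇ᵐu(t)|² ≤ S m` (`m ≤ n`),
`∫ |∇^{n+1}f(t)|² ≤ F` (`t ∈ [0, T]`) and `∫₀ᵀ ∫ χ_R² |∇^{n+1}u|² ≤ I` (`R ≥ 1`):
`∫ |∇^{n+1}u(t)|² ≤ M` for `t ∈ [0, T]` and `∫₀ᵀ ∫ χ_R² |∇^{n+2}u|² ≤ M` for `R ≥ 1` (the tree's
`sobolev_step_forced`, constant first). [cite: DoeringGibbon1995, §6.2 Thm. 6.1 with eq. (6.2.8) (p. 99)] -/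
theorem sobolev_step_forced_quant {ν Tmax : ℝ} (hν : 0 < ν) (hTmax : 0 < Tmax) {n : ℕ} (hn : 1 ≤ n)
    (S : ℕ → ℝ) (hS : ∀ m, 0 ≤ S m) {F I D₀ : ℝ} (hF : 0 ≤ F) (hI0 : 0 ≤ I) (hD₀ : 0 ≤ D₀) :
    ∃ M : ℝ, 0 ≤ M ∧ ∀ ⦃T : ℝ⦄ ⦃f u : ℝ → EuclideanSpace ℝ (Fin 3) → EuclideanSpace ℝ (Fin 3)⦄
      ⦃p : ℝ → EuclideanSpace ℝ (Fin 3) → ℝ⦄,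
      IsClassicalNSSolutionOn (Icc 0 T) ν f u p → 0 < T → T ≤ Tmax →
      Integrable (levelSq (n + 1) (u 0)) → (∫ x, levelSq (n + 1) (u 0) x ≤ D₀) →
      (∀ m ≤ n, ∀ t ∈ Icc 0 T, Integrable (levelSq m (u t)) ∧ ∫ x, levelSq m (u t) x ≤ S m) →
      (∀ t ∈ Icc 0 T, Integrable (levelSq (n + 1) (f t)) ∧ ∫ x, levelSq (n + 1) (f t) x ≤ F) →
      (∀ R : ℝ, 1 ≤ R →
        ∫ τ in Ioo 0 T, ∫ x, cutoff R x ^ 2 * levelSq (n + 1) (u τ) x ≤ I) →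
      (∀ t ∈ Icc 0 T,
          Integrable (levelSq (n + 1) (u t)) ∧ ∫ x, levelSq (n + 1) (u t) x ≤ M) ∧
        ∀ R : ℝ, 1 ≤ R →
          ∫ τ in Ioo 0 T, ∫ x, cutoff R x ^ 2 * levelSq (n + 2) (u τ) x ≤ M := by
  have h4D : 0 ≤ 4 * D₀ := by positivity
  obtain ⟨M, hM0, hM⟩ := uniform_enstrophy_bounds_forced_quant hν hTmax hn S hS hF hI0 h4D
  obtain ⟨c, hc0, hc⟩ := exists_abs_pderiv_cutoff_le
  refine ⟨max (M + 48 * c ^ 2 * S n) (M + 48 * c ^ 2 * I),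
    le_max_of_le_left (by nlinarith [hS n, sq_nonneg c]),
    fun T f u p h hT hTle hdat hdatle hPS hPF hPI => ?_⟩
  have h0T : (0 : ℝ) ∈ Icc 0 T := ⟨le_rfl, hT.le⟩
  have hu0 : ContDiff ℝ ∞ (u 0) := h.contDiff_velocity h0T
  -- the initial localised vorticity energy
  have hvort0 : Integrable (vortSq n (u 0)) := by
    refine (hdat.const_mul 4).mono' (continuous_vortSq hu0 n).aestronglyMeasurable
      (Eventually.of_forall fun x => ?_)
    rw [Real.norm_of_nonneg (vortSq_nonneg n _ x)]
    exact vortSq_le_four_mul_levelSq_succ hu0 n x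
  have hX₀ : ∀ R : ℝ, 1 ≤ R → ∫ x, cutoff R x ^ 4 * vortSq n (u 0) x ≤ 4 * D₀ := by
    intro R hR
    have hR0 : 0 < R := by linarith
    calc ∫ x, cutoff R x ^ 4 * vortSq n (u 0) x ≤ ∫ x, vortSq n (u 0) x :=
          integral_pow_mul_le_integral (continuous_vortSq hu0 n) (vortSq_nonneg n _) hvort0
            (contDiff_cutoff (E := EuclideanSpace ℝ (Fin 3)) R)
            (hasCompactSupport_cutoff (E := EuclideanSpace ℝ (Fin 3)) hR0)
            (cutoff_nonneg R) (cutoff_le_one R) (by norm_num)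
      _ ≤ ∫ x, 4 * levelSq (n + 1) (u 0) x :=
          integral_mono hvort0 (hdat.const_mul 4) fun x => vortSq_le_four_mul_levelSq_succ hu0 n x
      _ = 4 * ∫ x, levelSq (n + 1) (u 0) x := integral_const_mul _ _
      _ ≤ 4 * D₀ := by linarith
  have hM' := hM h hT hTle hPS hPF hPI hX₀
  refine ⟨fun t ht => ?_, fun R hR => ?_⟩
  · obtain ⟨hi, hle⟩ := h.integrable_levelSq_succ_of_uniform_anyForce hc ht hM0
      (fun R hR => (hM' R hR).1 t ht) (hPS n le_rfl t ht).1 (hPS n le_rfl t ht).2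
    exact ⟨hi, hle.trans (le_max_left _ _)⟩
  · exact (h.integral_Ioo_cutoff_levelSq_le_of_uniform_anyForce hT hc (fun R' hR' => (hM' R' hR').2)
      hPI hR).trans (le_max_right _ _)

/-! ## The restarted induction with uniform constants -/

/-- Translation of set integrals over `Ioo` (Lebesgue measure is translation invariant); a local
copy of the tree's private `setIntegral_Ioo_translate'`. [folklore] -/
private theorem setIntegral_Ioo_translate₃ (F : ℝ → ℝ) (a c d : ℝ) :
    ∫ τ in Ioo c d, F (τ + a) = ∫ τ in Ioo (c + a) (d + a), F τ := by
  have h := (measurePreserving_add_right (volume : Measure ℝ) a).setIntegral_preimage_emb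
    (MeasurableEquiv.addRight a).measurableEmbedding F (Ioo (c + a) (d + a))
  simp only [preimage_add_const_Ioo, add_sub_cancel_right] at h
  exact h

/-- **The restarted persistence step WITH force, with uniform constants.** Given `ν > 0`, `T > 0`,
`n ≥ 1`, times `0 ≤ a < b < T`, a bound `M ≥ 0` and force bounds `Fb m ≥ 0`, there is `M' ≥ 0`
such that for every classical solution `u` of the forced system (force `f`, with
`∫ |∇ᵐf(t)|² ≤ Fb m` on `[0, T]` for every `m`) on `[0, T] × ℝ³` whose levels hold at order `n`
from time `a` on with bound `M` — `∫ |∇ᵐu(t)|² ≤ M` for `m ≤ n`, `t ∈ [a, T]`, and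
`∫ₐᵀ ∫ χ_R² |∇^{n+1}u|² ≤ M` for `R ≥ 1` — the levels hold at order `n + 1` from time `b` on with
bound `M'`: pick a good time `t₀ ∈ (a, b)` with `∫ |∇^{n+1}u(t₀)|² ≤ M / (b − a)`
(`exists_integral_levelSq_le_anyForce`) and apply `sobolev_step_forced_quant` to the translate
`u(· + t₀)` on `[0, T − t₀]` — a solution with the translated force `f(· + t₀)`, whose slab bounds
persist. [cite: DoeringGibbon1995, §6.2 Thm. 6.1 with eq. (6.2.8) (p. 99)] -/
theorem sobolevLevels_succ_forced_quant {ν T : ℝ} (hν : 0 < ν) (hT : 0 < T) {n : ℕ} (hn : 1 ≤ n)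
    {a b : ℝ} (ha : 0 ≤ a) (hab : a < b) (hbT : b < T) {M : ℝ} (hM0 : 0 ≤ M) (Fb : ℕ → ℝ)
    (hFb : ∀ m, 0 ≤ Fb m) :
    ∃ M' : ℝ, 0 ≤ M' ∧ ∀ ⦃f u : ℝ → EuclideanSpace ℝ (Fin 3) → EuclideanSpace ℝ (Fin 3)⦄
      ⦃p : ℝ → EuclideanSpace ℝ (Fin 3) → ℝ⦄,
      IsClassicalNSSolutionOn (Icc 0 T) ν f u p →
      (∀ m : ℕ, ∀ t ∈ Icc 0 T, Integrable (levelSq m (f t)) ∧ ∫ x, levelSq m (f t) x ≤ Fb m) →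
      ((∀ m ≤ n, ∀ t ∈ Icc a T, Integrable (levelSq m (u t)) ∧ ∫ x, levelSq m (u t) x ≤ M) ∧
        ∀ R : ℝ, 1 ≤ R → ∫ τ in Ioo a T, ∫ x, cutoff R x ^ 2 * levelSq (n + 1) (u τ) x ≤ M) →
      ((∀ m ≤ n + 1, ∀ t ∈ Icc b T,
          Integrable (levelSq m (u t)) ∧ ∫ x, levelSq m (u t) x ≤ M') ∧
        ∀ R : ℝ, 1 ≤ R →
          ∫ τ in Ioo b T, ∫ x, cutoff R x ^ 2 * levelSq (n + 1 + 1) (u τ) x ≤ M') := by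
  have hba : 0 < b - a := by linarith
  obtain ⟨M₁, hM₁0, hM₁⟩ := sobolev_step_forced_quant hν hT hn (fun _ => M) (fun _ => hM0)
    (hFb (n + 1)) hM0 (div_nonneg hM0 hba.le)
  refine ⟨max M M₁, le_max_of_le_left hM0, fun f u p h hFf hL => ?_⟩
  obtain ⟨hS, hI⟩ := hL
  obtain ⟨t₀, ht₀, hdat, hdatle⟩ := h.exists_integral_levelSq_le_anyForce ha hab hbT.le (n + 1) hI
  have ht₀0 : 0 ≤ t₀ := ha.trans ht₀.1.le
  have ht₀T : t₀ < T := ht₀.2.trans hbT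
  have hT' : 0 < T - t₀ := by linarith
  have h' := h.translate_Icc_zero_anyForce ht₀0 ht₀T
  -- hypotheses of `sobolev_step_forced_quant` in the translated frame
  have hdat' : Integrable (levelSq (n + 1) ((fun t => u (t + t₀)) 0)) := by
    simpa only [zero_add] using hdat
  have hdatle' : ∫ x, levelSq (n + 1) ((fun t => u (t + t₀)) 0) x ≤ M / (b - a) := by
    simpa only [zero_add] using hdatle
  have hPS' : ∀ m ≤ n, ∀ t ∈ Icc 0 (T - t₀),
      Integrable (levelSq m (u (t + t₀))) ∧ ∫ x, levelSq m (u (t + t₀)) x ≤ M :=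
    fun m hm t ht => hS m hm (t + t₀) ⟨by linarith [ht.1, ht₀.1], by linarith [ht.2]⟩
  have hPF' : ∀ t ∈ Icc 0 (T - t₀),
      Integrable (levelSq (n + 1) (f (t + t₀))) ∧ ∫ x, levelSq (n + 1) (f (t + t₀)) x ≤ Fb (n + 1) :=
    fun t ht => hFf (n + 1) (t + t₀) ⟨by linarith [ht.1], by linarith [ht.2]⟩
  have hPI' : ∀ R : ℝ, 1 ≤ R →
      ∫ τ in Ioo 0 (T - t₀), ∫ x, cutoff R x ^ 2 * levelSq (n + 1) (u (τ + t₀)) x ≤ M := by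
    intro R hR
    have e := setIntegral_Ioo_translate₃
      (fun τ => ∫ x, cutoff R x ^ 2 * levelSq (n + 1) (u τ) x) t₀ 0 (T - t₀)
    rw [zero_add, sub_add_cancel] at e
    rw [e]
    exact (h.integral_Ioo_cutoff_levelSq_mono_left_anyForce hT (n + 1) ha ht₀.1.le hR).trans
      (hI R hR)
  obtain ⟨hS₁, hI₁⟩ := hM₁ h' hT' (by linarith) hdat' hdatle' hPS' hPF' hPI'
  refine ⟨fun m hm t ht => ?_, fun R hR => ?_⟩
  · rcases Nat.lt_or_ge m (n + 1) with hm' | hm'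
    · obtain ⟨hi, hle⟩ := hS m (Nat.lt_succ_iff.1 hm') t ⟨by linarith [ht.1], ht.2⟩
      exact ⟨hi, hle.trans (le_max_left _ _)⟩
    · have : m = n + 1 := le_antisymm hm hm'
      subst this
      have := hS₁ (t - t₀) ⟨by linarith [ht.1, ht₀.2], by linarith [ht.2]⟩
      simp only [sub_add_cancel] at this
      exact ⟨this.1, this.2.trans (le_max_right _ _)⟩
  · have e := setIntegral_Ioo_translate₃
      (fun τ => ∫ x, cutoff R x ^ 2 * levelSq (n + 1 + 1) (u τ) x) t₀ 0 (T - t₀)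
    rw [zero_add, sub_add_cancel] at e
    have hI₁' : ∫ τ in Ioo t₀ T, ∫ x, cutoff R x ^ 2 * levelSq (n + 1 + 1) (u τ) x ≤ M₁ := by
      rw [← e]; exact hI₁ R hR
    exact ((h.integral_Ioo_cutoff_levelSq_mono_left_anyForce hT (n + 1 + 1) ht₀0 ht₀.2.le
      hR).trans hI₁').trans (le_max_right _ _)

/-- **All levels after any positive time WITH force, with uniform constants.** Given `ν > 0`,
`T > 0`, a level-one bound `M ≥ 0`, force bounds `Fb m ≥ 0`, an order `n ≥ 1` and a time
`b ∈ (0, T)`, there is `M' ≥ 0` such that every classical solution `u` of the forced system on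
`[0, T] × ℝ³` (force `f` with `∫ |∇ᵐf(t)|² ≤ Fb m` on `[0, T]` for every `m`) with `∫ |u(t)|²`,
`∫ |∇u(t)|² ≤ M` (`t ∈ [0, T]`) and `∫₀ᵀ ∫ χ_R² |∇²u|² ≤ M` (`R ≥ 1`) has `∫ |∇ᵐu(t)|² ≤ M'` for all
`m ≤ n`, `t ∈ [b, T]`, and `∫_bᵀ ∫ χ_R² |∇^{n+1}u|² ≤ M'` for `R ≥ 1` (induction on `n`, restarting
at `b/2` with `sobolevLevels_succ_forced_quant`). [cite: DoeringGibbon1995, §6.2 Thm. 6.1 with eq. (6.2.8) (p. 99)] -/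
theorem sobolevLevels_forced_quant {ν T : ℝ} (hν : 0 < ν) (hT : 0 < T) {M : ℝ} (hM0 : 0 ≤ M)
    (Fb : ℕ → ℝ) (hFb : ∀ m, 0 ≤ Fb m) (n : ℕ) (hn : 1 ≤ n) {b : ℝ} (hb : 0 < b) (hbT : b < T) :
    ∃ M' : ℝ, 0 ≤ M' ∧ ∀ ⦃f u : ℝ → EuclideanSpace ℝ (Fin 3) → EuclideanSpace ℝ (Fin 3)⦄
      ⦃p : ℝ → EuclideanSpace ℝ (Fin 3) → ℝ⦄,
      IsClassicalNSSolutionOn (Icc 0 T) ν f u p →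
      (∀ m : ℕ, ∀ t ∈ Icc 0 T, Integrable (levelSq m (f t)) ∧ ∫ x, levelSq m (f t) x ≤ Fb m) →
      ((∀ m ≤ 1, ∀ t ∈ Icc 0 T, Integrable (levelSq m (u t)) ∧ ∫ x, levelSq m (u t) x ≤ M) ∧
        ∀ R : ℝ, 1 ≤ R → ∫ τ in Ioo 0 T, ∫ x, cutoff R x ^ 2 * levelSq 2 (u τ) x ≤ M) →
      ((∀ m ≤ n, ∀ t ∈ Icc b T, Integrable (levelSq m (u t)) ∧ ∫ x, levelSq m (u t) x ≤ M') ∧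
        ∀ R : ℝ, 1 ≤ R →
          ∫ τ in Ioo b T, ∫ x, cutoff R x ^ 2 * levelSq (n + 1) (u τ) x ≤ M') := by
  induction n, hn using Nat.le_induction generalizing b with
  | base =>
      refine ⟨M, hM0, fun f u p h _ hL => ⟨fun m hm t ht => hL.1 m hm t ⟨hb.le.trans ht.1, ht.2⟩,
        fun R hR => (h.integral_Ioo_cutoff_levelSq_mono_left_anyForce hT 2 le_rfl hb.le hR).trans
          (hL.2 R hR)⟩⟩
  | succ n hn ih =>
      obtain ⟨M', hM'0, hM'⟩ := ih (b := b / 2) (by linarith) (by linarith)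
      obtain ⟨M'', hM''0, hM''⟩ := sobolevLevels_succ_forced_quant hν hT hn
        (by linarith : (0 : ℝ) ≤ b / 2) (by linarith : b / 2 < b) hbT hM'0 Fb hFb
      exact ⟨M'', hM''0, fun f u p h hFf hL => hM'' h hFf (hM' h hFf hL)⟩

/-! ## Lemma 5.5 WITH force -/

/-- **Tao 2011, Lemma 5.5 (Quantitative regularity) WITH FORCE** (arXiv:1108.1165, Lemma 32,
pp. 18–19 = Anal. PDE 6 (2013), Lemma 5.5, printed with the forcing term:
"`‖u‖_{L^∞_t H^k_x([τ,T] × ℝ³)} ≲_{k,τ,T,M} 1` for all natural numbers `k ≥ 1` and all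
`0 < τ < T`"), viscosity `ν > 0`, classical solutions of the forced system on the closed slab,
hypothesis the `X¹` bound with which the printed proof starts together with slab bounds on all
derivatives of the force (Tao's smooth `L^∞_t H^k_x` forces — the class of the note closing the
proof of Thm. 5.4; in particular every Clay-class force): for every order `k`, viscosity `ν > 0`,
times `0 < τ < T`, bounds `E, S, I` and force bounds `F m` there is `C = C(k, ν, τ, T, E, S, I, F)`
such that every classical solution `(u, p)` of the system forced by `f` on `[0, T] × ℝ³` with
`∫ ‖Dᵐf(t)‖² ≤ F m` (`t ∈ [0, T]`, all `m`), `∫|u(t)|² ≤ E`, `∫|∇u(t)|² ≤ S` on `[0, T]` and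
`∫₀ᵀ∫‖D²u‖² ≤ I` satisfies `∫ ‖Dᵏu(t)‖² ≤ C` for all `t ∈ [τ, T]`. The constant is chosen BEFORE the
solution and the force (the homogeneous `tao2011_quantitative_regularity` with the force slot
opened); the proof is the physical-space energy method of the tree made quantitative
(`sobolevLevels_forced_quant`), not Tao's Duhamel argument. [cite: Tao2011, Lemma 5.5] -/
theorem tao2011_quantitative_regularity_forced (k : ℕ) {ν τ T : ℝ} (hν : 0 < ν) (hτ : 0 < τ)
    (hτT : τ < T) (E S I : ℝ≥0) (F : ℕ → ℝ≥0) :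
    ∃ C : ℝ≥0, ∀ ⦃f u : ℝ → EuclideanSpace ℝ (Fin 3) → EuclideanSpace ℝ (Fin 3)⦄
      ⦃p : ℝ → EuclideanSpace ℝ (Fin 3) → ℝ⦄,
      IsClassicalNSSolutionOn (Icc 0 T) ν f u p →
      (∀ m : ℕ, ∀ t ∈ Icc 0 T, ∫⁻ x, ‖iteratedFDeriv ℝ m (f t) x‖ₑ ^ 2 ≤ F m) →
      (∀ t ∈ Icc 0 T, ∫⁻ x, ‖u t x‖ₑ ^ 2 ≤ E) →
      (∀ t ∈ Icc 0 T, (∫⁻ x, ENNReal.ofReal (frobeniusNormSq (fderiv ℝ (u t) x))) ≤ S) →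
      (∫⁻ t in Ioo 0 T, ∫⁻ x, ‖iteratedFDeriv ℝ 2 (u t) x‖ₑ ^ 2) ≤ I →
      ∀ t ∈ Icc τ T, ∫⁻ x, ‖iteratedFDeriv ℝ k (u t) x‖ₑ ^ 2 ≤ C := by
  have hT : 0 < T := hτ.trans hτT
  -- one level-one bound for the three hypotheses on `u`
  set M : ℝ := (E : ℝ) + (S : ℝ) + 27 * (I : ℝ) with hM
  have hM0 : 0 ≤ M := by positivity
  have hEM : (E : ℝ) ≤ M := by rw [hM]; nlinarith [S.coe_nonneg, I.coe_nonneg]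
  have hSM : (S : ℝ) ≤ M := by rw [hM]; nlinarith [E.coe_nonneg, I.coe_nonneg]
  have hIM : 27 * (I : ℝ) ≤ M := by rw [hM]; nlinarith [E.coe_nonneg, S.coe_nonneg]
  -- the force bounds in coordinate-tensor form
  set Fb : ℕ → ℝ := fun m => 3 ^ (m + 1) * (F m : ℝ) with hFb
  have hFb0 : ∀ m, 0 ≤ Fb m := fun m => by rw [hFb]; positivity
  obtain ⟨M', hM'0, hM'⟩ := sobolevLevels_forced_quant hν hT hM0 Fb hFb0 (max k 1)
    (le_max_right _ _) hτ hτT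
  refine ⟨(3 ^ (k + 1) * M').toNNReal, fun f u p h hFf hE hS hI t ht => ?_⟩
  have hTT : T ∈ Icc 0 T := ⟨hT.le, le_rfl⟩
  have hU := uniqueDiffOn_Icc hT
  -- the force hypotheses in coordinate-tensor form
  have hfrc : ∀ m : ℕ, ∀ s ∈ Icc 0 T,
      Integrable (levelSq m (f s)) ∧ ∫ x, levelSq m (f s) x ≤ Fb m := by
    intro m s hs
    have hg := h.contDiff_force hU hs
    have hfin : ∫⁻ x, ‖iteratedFDeriv ℝ m (f s) x‖ₑ ^ 2 < ⊤ :=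
      (hFf m s hs).trans_lt ENNReal.coe_lt_top
    obtain ⟨hint, hle⟩ := integrable_levelSq_of_lintegral_lt_top hg m hfin
    refine ⟨hint, hle.trans ?_⟩
    rw [hFb]
    refine mul_le_mul_of_nonneg_left ?_ (by positivity)
    have := ENNReal.toReal_mono ENNReal.coe_ne_top (hFf m s hs)
    simpa using this
  -- the level-one hypotheses in coordinate-tensor form
  have hlev : ∀ m ≤ 1, ∀ s ∈ Icc 0 T,
      Integrable (levelSq m (u s)) ∧ ∫ x, levelSq m (u s) x ≤ M := by
    intro m hm s hs
    have hv := h.contDiff_velocity hs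
    rcases Nat.le_one_iff_eq_zero_or_eq_one.1 hm with rfl | rfl
    · -- level `0`: `|∇⁰u|² = |u|²`
      have hle : ∫⁻ x, ENNReal.ofReal (levelSq 0 (u s) x) ≤ ENNReal.ofReal M := by
        calc ∫⁻ x, ENNReal.ofReal (levelSq 0 (u s) x) = ∫⁻ x, ‖u s x‖ₑ ^ 2 :=
              lintegral_congr fun x => by
                rw [levelSq_zero_eq_norm_sq, ENNReal.ofReal_pow (norm_nonneg _), ofReal_norm]
          _ ≤ E := hE s hs
          _ ≤ ENNReal.ofReal M := by
              rw [← ENNReal.ofReal_coe_nnreal]; exact ENNReal.ofReal_le_ofReal hEM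
      exact integrable_and_integral_le_of_lintegral_ofReal_le (continuous_levelSq hv 0)
        (levelSq_nonneg 0 _) hM0 hle
    · -- level `1`: `|∇u|² = |Du|²_F`
      have hle : ∫⁻ x, ENNReal.ofReal (levelSq 1 (u s) x) ≤ ENNReal.ofReal M := by
        calc ∫⁻ x, ENNReal.ofReal (levelSq 1 (u s) x)
              = ∫⁻ x, ENNReal.ofReal (frobeniusNormSq (fderiv ℝ (u s) x)) :=
              lintegral_congr fun x => by
                rw [levelSq_one_eq_frobeniusNormSq
                  ((hv.differentiable (by simp)).differentiableAt)]
          _ ≤ S := hS s hs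
          _ ≤ ENNReal.ofReal M := by
              rw [← ENNReal.ofReal_coe_nnreal]; exact ENNReal.ofReal_le_ofReal hSM
      exact integrable_and_integral_le_of_lintegral_ofReal_le (continuous_levelSq hv 1)
        (levelSq_nonneg 1 _) hM0 hle
  -- the dissipation: `∫₀ᵀ ∫ χ_R² |∇²u|² ≤ 27 ∫₀ᵀ ∫⁻ ‖D²u‖ₑ² ≤ 27 I`
  have hdis : ∀ R : ℝ, 1 ≤ R → ∫ s in Ioo 0 T, ∫ x, cutoff R x ^ 2 * levelSq 2 (u s) x ≤ M := by
    intro R hR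
    have hR0 : 0 < R := by linarith
    have cY := h.continuousOn_integral_cutoff_pow_mul_levelSq_anyForce hT hR0 2 2 two_ne_zero
    have iY := integrableOn_Ioo_of_continuousOn cY hTT
    have hY0 : ∀ s, 0 ≤ ∫ x, cutoff R x ^ 2 * levelSq 2 (u s) x := fun s =>
      integral_nonneg fun x => mul_nonneg (sq_nonneg _) (levelSq_nonneg _ _ _)
    have h27 : ENNReal.ofReal (∫ s in Ioo 0 T, ∫ x, cutoff R x ^ 2 * levelSq 2 (u s) x) ≤
        ENNReal.ofReal (3 ^ (2 + 1)) * I := by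
      rw [ofReal_integral_eq_lintegral_ofReal iY (ae_of_all _ hY0)]
      calc ∫⁻ s in Ioo 0 T, ENNReal.ofReal (∫ x, cutoff R x ^ 2 * levelSq 2 (u s) x)
          ≤ ∫⁻ s in Ioo 0 T, ENNReal.ofReal (3 ^ (2 + 1)) *
              ∫⁻ x, ‖iteratedFDeriv ℝ 2 (u s) x‖ₑ ^ 2 :=
            setLIntegral_mono' measurableSet_Ioo fun s hs' =>
              ofReal_integral_cutoff_sq_mul_levelSq_le
                (h.contDiff_velocity ⟨hs'.1.le, hs'.2.le⟩) hR0 2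
        _ = ENNReal.ofReal (3 ^ (2 + 1)) *
              ∫⁻ s in Ioo 0 T, ∫⁻ x, ‖iteratedFDeriv ℝ 2 (u s) x‖ₑ ^ 2 :=
            lintegral_const_mul' _ _ ENNReal.ofReal_ne_top
        _ ≤ ENNReal.ofReal (3 ^ (2 + 1)) * I := by gcongr
    have h27' : ∫ s in Ioo 0 T, ∫ x, cutoff R x ^ 2 * levelSq 2 (u s) x ≤ 27 * I := by
      rw [← ENNReal.ofReal_le_ofReal_iff (by positivity)]
      refine h27.trans (le_of_eq ?_)
      rw [ENNReal.ofReal_mul (by norm_num), ENNReal.ofReal_coe_nnreal]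
      norm_num
    exact h27'.trans hIM
  -- the levels at order `max k 1` from time `τ` on, and back to `‖Dᵏu‖²`
  obtain ⟨hi, hle⟩ := (hM' h hfrc ⟨hlev, hdis⟩).1 k (le_max_left _ _) t ht
  have hv := h.contDiff_velocity ⟨hτ.le.trans ht.1, ht.2⟩
  refine (lintegral_sq_norm_iteratedFDeriv_le hv k hi).trans ?_
  rw [← ENNReal.ofReal_coe_nnreal, Real.coe_toNNReal']
  exact ENNReal.ofReal_le_ofReal (le_trans (mul_le_mul_of_nonneg_left hle (by positivity))
    (le_max_left _ _))

/-- **Clay-class corollary.** For a force smooth on `[0, ∞) × ℝ³` with Fefferman's space-time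
decay (5) the slab bounds `sup_{t ≥ 0} ∫‖Dᵐf(t)‖² < ∞` hold for every `m`
(`HasRapidSpaceTimeDecay.exists_lintegral_iteratedFDeriv_slice_sq_le_all`), so Lemma 5.5 WITH
force applies with a family `F` depending on `f` only: for every Clay-class `f`, order `k`,
`ν > 0`, `0 < τ < T` and `E, S, I` there is `C` bounding `∫‖Dᵏu(t)‖²` on `[τ, T]` for every classical
solution of the system forced by `f` on `[0, T] × ℝ³` with the three `X¹`-type bounds.
[cite: Tao2011, Lemma 5.5] -/
theorem tao2011_quantitative_regularity_clayForce (k : ℕ) {ν τ T : ℝ} (hν : 0 < ν) (hτ : 0 < τ)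
    (hτT : τ < T) (E S I : ℝ≥0) {f : ℝ → EuclideanSpace ℝ (Fin 3) → EuclideanSpace ℝ (Fin 3)}
    (hfs : IsSmoothOnHalfSpace f) (hfd : HasRapidSpaceTimeDecay f) :
    ∃ C : ℝ≥0, ∀ ⦃u : ℝ → EuclideanSpace ℝ (Fin 3) → EuclideanSpace ℝ (Fin 3)⦄
      ⦃p : ℝ → EuclideanSpace ℝ (Fin 3) → ℝ⦄,
      IsClassicalNSSolutionOn (Icc 0 T) ν f u p →
      (∀ t ∈ Icc 0 T, ∫⁻ x, ‖u t x‖ₑ ^ 2 ≤ E) →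
      (∀ t ∈ Icc 0 T, (∫⁻ x, ENNReal.ofReal (frobeniusNormSq (fderiv ℝ (u t) x))) ≤ S) →
      (∫⁻ t in Ioo 0 T, ∫⁻ x, ‖iteratedFDeriv ℝ 2 (u t) x‖ₑ ^ 2) ≤ I →
      ∀ t ∈ Icc τ T, ∫⁻ x, ‖iteratedFDeriv ℝ k (u t) x‖ₑ ^ 2 ≤ C := by
  have hF : ∀ m : ℕ, ∃ C : ℝ≥0, ∀ t, 0 ≤ t → ∫⁻ x, ‖iteratedFDeriv ℝ m (f t) x‖ₑ ^ 2 ≤ C :=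
    fun m => hfd.exists_lintegral_iteratedFDeriv_slice_sq_le_all (μ := volume) hfs m
  choose F hF using hF
  obtain ⟨C, hC⟩ := tao2011_quantitative_regularity_forced k hν hτ hτT E S I F
  exact ⟨C, fun u p h hE hS hI => hC h (fun m t ht => hF m t ht.1) hE hS hI⟩

end Literature.Analysis.FluidPDE

end
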